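import Summits.PneNP.PneNP.Theorems.CliqueExtLowerBound.Negative.PermConsequences
import Summits.PneNP.PneNP.Theorems.ConvexRankGatesXorUnsatIsOnePermGate
import HarnessLib

/-!
# Crux `Capture` (stmt-PneNP-2659) — duality audit, cell D2: the DUAL of an `𝔽₂`-span (abelian PERM)
# gate is again an `𝔽₂`-span gate, hence ONE PERM gate (span-program duality)

A monotone span program over `𝔽₂` — `f v = 1 ↔ t ∈ span {a i : v i = 1}` — is one PERM gate
(`abelianProgram_isPermGate`; the route's XOR-UNSAT door `XorUnsatIsOnePermGate` is the instance
`t = (0,1)`, `a e = (lhs e, rhs e)`). The crux `Capture` predicts that the Boolean DUAL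
`f^d(x) = ¬ f(¬ x)` of every tame door is again a polynomial extended circuit; the dual of the span gate is

  `f^d v = 1 ↔ t ∉ span {a i : v i = 0}`   (non-membership in the span of the UNselected rows).

This file proves that `f^d` is itself an `𝔽₂`-span gate with one row per wire in an ambient space of
dimension `≤ N + 1` (`N` = arity), hence ONE PERM gate on `≤ 2 (N + 1)` points (`dualSpan_onePermGate`).
The construction is the classical dual span program (Karchmer–Wigderson 1993; Gál 2001, Thm. 3.1:
`mSP_F(f) = mSP_F(f^d)`), in the following coordinate-free form: with
`Ψ : V* → F^N × F`, `w ↦ ((w (a i))_i, w t)` and `U = range Ψ`,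

  `t ∉ span {a i : i ∉ T}  ↔  ∃ w ∈ V*, w t = 1 ∧ w (a i) = 0 (i ∉ T)`        (Hahn–Banach over a field)
  `                        ↔  (0, 1) ∈ U + span {(e_i, 0) : i ∈ T}`            (bookkeeping)
  `                        ↔  [(0,1)] ∈ span {[(e_i, 0)] : i ∈ T}` in `(F^N × F) ⧸ U` (quotient),

i.e. the dual gate has rows `[(e_i, 0)]` and target `[(0,1)]` in the quotient space. As a corollary the
dual of the XOR-UNSAT door — `[the UNselected affine 𝔽₂-system is satisfiable]` — is one PERM gate
(`dualXorSat_onePermGate`). Hence the duality audit PASSES on abelian (`𝔽₂`) PERM gates.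
-- TODO(general form): the same proof works verbatim over every finite field `𝔽_q` (PERM width
-- `q (N + 1)`); only the `𝔽₂` bridge `mem_closure_image_iff_mem_span` of the XOR-UNSAT file is reused here.
[folklore; Gál 2001 Thm. 3.1]
-/

namespace Summit.PneNP.PneNP.Theorems.Capture.DualityAudit

set_option linter.dupNamespace false -- `Summit.PneNP.PneNP.…`: summit = sub-problem (D-0017)

open Literature.Computability.Complexity
open Summit.PneNP.PneNP.Theorems.CliqueExtLowerBound.Negative (abelianProgram_isPermGate)
open Summit.PneNP.PneNP.Theorems (mem_closure_image_iff_mem_span zeroOne_mem_span_iff_xorUnsat)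

section Field

variable {F : Type*} [Field F] {V : Type*} [AddCommGroup V] [Module F V] {N : ℕ}

/-- **Hahn–Banach form of non-membership**: `t` lies outside the span of the rows `a i, i ∈ S` iff some
linear functional takes the value `1` at `t` and kills those rows. [folklore] -/
theorem not_mem_span_image_iff_exists_dual (a : Fin N → V) (t : V) (S : Set (Fin N)) :
    t ∉ Submodule.span F (a '' S) ↔ ∃ w : Module.Dual F V, w t = 1 ∧ ∀ i ∈ S, w (a i) = 0 := by
  constructor
  · intro ht
    obtain ⟨f, hft, hf⟩ := Submodule.exists_dual_map_eq_bot_of_notMem ht inferInstance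
    refine ⟨(f t)⁻¹ • f, ?_, fun i hi => ?_⟩
    · rw [LinearMap.smul_apply, smul_eq_mul, inv_mul_cancel₀ hft]
    · have hmem : f (a i) ∈ Submodule.map f (Submodule.span F (a '' S)) :=
        Submodule.mem_map_of_mem (Submodule.subset_span ⟨i, hi, rfl⟩)
      rw [hf, Submodule.mem_bot] at hmem
      rw [LinearMap.smul_apply, hmem, smul_zero]
  · rintro ⟨w, hwt, hw⟩ ht
    have hle : Submodule.span F (a '' S) ≤ LinearMap.ker w := by
      rw [Submodule.span_le]
      rintro _ ⟨i, hi, rfl⟩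
      exact hw i hi
    have h0 := hle ht
    rw [LinearMap.mem_ker, hwt] at h0
    exact one_ne_zero h0

/-- **Bookkeeping**: a functional `w` with `w t = 1` killing the rows off `T` is the same thing as a
representation `(0,1) = Ψ w + ∑_{i ∈ T} cᵢ (eᵢ, 0)`, where `Ψ w = ((w (a i))ᵢ, w t)`. [folklore] -/
theorem exists_dual_iff_mem_sup (a : Fin N → V) (t : V) (T : Set (Fin N)) :
    (∃ w : Module.Dual F V, w t = 1 ∧ ∀ i ∉ T, w (a i) = 0) ↔
      ((0 : Fin N → F), (1 : F)) ∈ LinearMap.range (LinearMap.prod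
          (LinearMap.pi fun i => Module.Dual.eval F V (a i)) (Module.Dual.eval F V t)) ⊔
        Submodule.span F ((fun i => ((Pi.single i 1 : Fin N → F), (0 : F))) '' T) := by
  classical
  constructor
  · rintro ⟨w, hwt, hw⟩
    rw [Submodule.mem_sup]
    let c : Fin N → F := fun i => w (a i)
    refine ⟨(c, 1), ⟨w, ?_⟩, (-c, 0), ?_, ?_⟩
    · ext i
      · rfl
      · exact hwt
    · -- `(-c, 0) = ∑ i, (-c i) • (e_i, 0)` and the summands off `T` vanish
      have hsum : ((-c, (0 : F)) : (Fin N → F) × F) =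
          ∑ i, (-c i) • ((Pi.single i 1 : Fin N → F), (0 : F)) := by
        ext j
        · simp [Prod.fst_sum, Finset.sum_apply, Pi.single_apply]
        · simp [Prod.snd_sum]
      rw [hsum]
      refine Submodule.sum_mem _ fun i _ => ?_
      by_cases hi : i ∈ T
      · exact Submodule.smul_mem _ _ (Submodule.subset_span ⟨i, hi, rfl⟩)
      · have : c i = 0 := hw i hi
        rw [this, neg_zero, zero_smul]
        exact Submodule.zero_mem _
    · ext i <;> simp
  · intro h
    rw [Submodule.mem_sup] at h
    obtain ⟨u, ⟨w, rfl⟩, y, hy, huy⟩ := h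
    -- elements of the span of the `(e_i, 0)`, `i ∈ T`, vanish off `T` and in the last coordinate
    have hyT : y.2 = 0 ∧ ∀ i ∉ T, y.1 i = 0 := by
      refine Submodule.span_induction (p := fun y _ => y.2 = 0 ∧ ∀ i ∉ T, y.1 i = 0) ?_ ?_ ?_ ?_ hy
      · rintro _ ⟨j, hj, rfl⟩
        refine ⟨rfl, fun i hi => ?_⟩
        have hij : i ≠ j := fun h => hi (h ▸ hj)
        simp [hij]
      · exact ⟨rfl, fun _ _ => rfl⟩
      · rintro x z - - ⟨hx2, hx1⟩ ⟨hz2, hz1⟩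
        exact ⟨by rw [Prod.snd_add, hx2, hz2, add_zero], fun i hi => by
          rw [Prod.fst_add, Pi.add_apply, hx1 i hi, hz1 i hi, add_zero]⟩
      · rintro r x - ⟨hx2, hx1⟩
        exact ⟨by rw [Prod.smul_snd, hx2, smul_zero], fun i hi => by
          rw [Prod.smul_fst, Pi.smul_apply, hx1 i hi, smul_zero]⟩
    refine ⟨w, ?_, fun i hi => ?_⟩
    · have h2 := congrArg Prod.snd huy
      simp only [Prod.snd_add, LinearMap.prod_apply, hyT.1, add_zero] at h2
      exact h2
    · have h1 := congrArg (fun x => x.1 i) huy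
      simp only [Prod.fst_add, Pi.add_apply, LinearMap.prod_apply, hyT.2 i hi, add_zero] at h1
      exact h1

/-- **Quotient form**: membership in `U ⊔ span G` is membership of the class in the span of the
classes, in the quotient by `U`. [folklore] -/
theorem mem_sup_span_iff_mkQ {E : Type*} [AddCommGroup E] [Module F E] (U : Submodule F E)
    (G : Set E) (x : E) :
    x ∈ U ⊔ Submodule.span F G ↔ U.mkQ x ∈ Submodule.span F (U.mkQ '' G) := by
  rw [← Submodule.map_span, ← Submodule.mem_comap, Submodule.comap_map_mkQ]

/-- **Coordinates**: a linear equivalence transports span membership. [folklore] -/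
theorem mem_span_image_iff_equiv {E E' : Type*} [AddCommGroup E] [Module F E] [AddCommGroup E']
    [Module F E'] (e : E ≃ₗ[F] E') {ι : Type*} (g : ι → E) (T : Set ι) (x : E) :
    x ∈ Submodule.span F (g '' T) ↔ e x ∈ Submodule.span F ((fun i => e (g i)) '' T) := by
  have himg : (fun i => e (g i)) '' T = (e : E →ₗ[F] E') '' (g '' T) := by
    rw [Set.image_image]; rfl
  rw [himg, ← Submodule.map_span, Submodule.mem_map_equiv, LinearEquiv.symm_apply_apply]

/-- **The dual span program, coordinate-free**: for rows `a i ∈ V` and target `t`, with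
`U = range (w ↦ ((w (a i))ᵢ, w t)) ≤ F^N × F`, the DUAL function `[t ∉ span {a i : i ∉ T}]` is the span
program with rows `[(eᵢ, 0)]` and target `[(0, 1)]` in the quotient `(F^N × F) ⧸ U`. [folklore; Gál 2001
Thm. 3.1] -/
theorem not_mem_span_compl_iff_mkQ_mem_span (a : Fin N → V) (t : V) (T : Set (Fin N)) :
    t ∉ Submodule.span F (a '' Tᶜ) ↔
      (LinearMap.range (LinearMap.prod (LinearMap.pi fun i => Module.Dual.eval F V (a i))
          (Module.Dual.eval F V t))).mkQ ((0 : Fin N → F), (1 : F)) ∈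
        Submodule.span F ((LinearMap.range (LinearMap.prod
            (LinearMap.pi fun i => Module.Dual.eval F V (a i)) (Module.Dual.eval F V t))).mkQ ''
          ((fun i => ((Pi.single i 1 : Fin N → F), (0 : F))) '' T)) := by
  rw [not_mem_span_image_iff_exists_dual, ← mem_sup_span_iff_mkQ, ← exists_dual_iff_mem_sup]
  simp only [Set.mem_compl_iff]

/-- Dimension count: the quotient `(F^N × F) ⧸ U` has dimension `≤ N + 1`. [folklore] -/
theorem finrank_quotient_prod_le (U : Submodule F ((Fin N → F) × F)) :
    Module.finrank F (((Fin N → F) × F) ⧸ U) ≤ N + 1 := by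
  have h := Submodule.finrank_quotient_add_finrank U
  rw [Module.finrank_prod, Module.finrank_fin_fun, Module.finrank_self] at h
  omega

end Field

section F2

variable {N : ℕ}

/-- **Duality-audit cell D2 (registered sub-goal `dualSpan_onePermGate`)**: the DUAL of an `𝔽₂`-span
gate — `f v = 1 ↔ t ∉ span_{𝔽₂} {a i : v i = 0}` (rows `a i` in ANY `𝔽₂`-space `V`, one per wire, target
`t`) — is ONE PERM gate on `≤ 2 (N + 1)` points (`N` = arity): the dual span program in the quotient
`(𝔽₂^N × 𝔽₂) ⧸ range Ψ`, embedded by the translation action of its additive group. [folklore; Gál 2001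
Thm. 3.1] -/
theorem dualSpan_onePermGate : ∀ (V : Type) [AddCommGroup V] [Module (ZMod 2) V] (N : ℕ)
    (a : Fin N → V) (t : V) (f : (Fin N → Bool) → Bool),
    (∀ v, f v = true ↔ t ∉ Submodule.span (ZMod 2) (a '' {i | v i = false})) →
    IsPermGate (2 * (N + 1)) ⟨N, f⟩ := by
  intro V _ _ N a t f hf
  classical
  -- the quotient space of the dual program and its coordinates
  let U : Submodule (ZMod 2) ((Fin N → ZMod 2) × ZMod 2) := LinearMap.range (LinearMap.prod
    (LinearMap.pi fun i => Module.Dual.eval (ZMod 2) V (a i))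
    (Module.Dual.eval (ZMod 2) V t))
  let Q := ((Fin N → ZMod 2) × ZMod 2) ⧸ U
  let m : ℕ := Module.finrank (ZMod 2) Q
  let e : Q ≃ₗ[ZMod 2] (Fin m → ZMod 2) := (Module.finBasis (ZMod 2) Q).equivFun
  let ρ : Fin N → Fin m → ZMod 2 := fun i => e (U.mkQ ((Pi.single i 1 : Fin N → ZMod 2), (0 : ZMod 2)))
  let τ : Fin m → ZMod 2 := e (U.mkQ ((0 : Fin N → ZMod 2), (1 : ZMod 2)))
  have hm : m ≤ N + 1 := finrank_quotient_prod_le U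
  -- semantics: `f v ↔ τ ∈ span (ρ '' on-wires)`
  have hsem : ∀ v : Fin N → Bool, f v = true ↔
      τ ∈ Submodule.span (ZMod 2) (ρ '' {i | v i = true}) := fun v => by
    have hc : ({i : Fin N | v i = true} : Set (Fin N))ᶜ = {i | v i = false} := by
      ext i; simp
    rw [hf v, ← hc, not_mem_span_compl_iff_mkQ_mem_span, mem_span_image_iff_equiv e, Set.image_image]
  -- the translation action makes it one PERM gate on `2 m ≤ 2 (N + 1)` points
  have hperm : IsPermGate (Fintype.card (ZMod 2 × Fin m)) ⟨N, f⟩ := by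
    refine abelianProgram_isPermGate ρ τ f fun v => ?_
    rw [hsem v, ← Set.image_image (fun x : Fin m → ZMod 2 => Multiplicative.ofAdd x) ρ,
      mem_closure_image_iff_mem_span (fun x : Fin m → ZMod 2 => Multiplicative.ofAdd x) rfl
        (fun _ _ => rfl) Multiplicative.ofAdd.injective]
  refine hperm.mono ?_
  rw [Fintype.card_prod, ZMod.card, Fintype.card_fin]
  omega

/-- **The dual of the XOR-UNSAT door is ONE PERM gate**: on the input type of all affine `𝔽₂`-equations
`(lhs, rhs) ∈ 𝔽₂ⁿ × 𝔽₂`, the monotone function `[the UNselected equations are simultaneously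
satisfiable]` — the Boolean dual of the route's door `XorUnsatIsOnePermGate` — is computed by a size-one
circuit whose gate is a PERM gate on `≤ 2 (2^(n+1) + 1)` points (polynomial in the arity `2^(n+1)`).
[folklore] -/
theorem dualXorSat_onePermGate : ∀ n : ℕ, ∃ C : Circuit ((Fin n → ZMod 2) × ZMod 2),
    C.IsOver {g | IsPermGate (2 * (2 ^ (n + 1) + 1)) g} ∧ C.size ≤ 1 ∧
      C.Computes (fun v => decide (∃ y : Fin n → ZMod 2, ∀ e, v e = false → e.1 ⬝ᵥ y = e.2)) := by
  intro n
  classical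
  let ι := (Fin n → ZMod 2) × ZMod 2
  let eI : ι ≃ Fin (Fintype.card ι) := Fintype.equivFin ι
  have hcard : Fintype.card ι = 2 ^ (n + 1) := by
    simp [ι, Fintype.card_prod, ZMod.card, pow_succ]
  -- the dual span gate on the wires `Fin |ι|`, rows `a = eI.symm`, target `(0, 1)`
  let g : (Fin (Fintype.card ι) → Bool) → Bool := fun u =>
    decide ((((0 : Fin n → ZMod 2), (1 : ZMod 2)) : ι) ∉
      Submodule.span (ZMod 2) ((fun i => eI.symm i) '' {i | u i = false}))
  have hg : IsPermGate (2 * (2 ^ (n + 1) + 1)) ⟨Fintype.card ι, g⟩ := by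
    have h := dualSpan_onePermGate ι (Fintype.card ι) (fun i => eI.symm i)
      ((0 : Fin n → ZMod 2), (1 : ZMod 2)) g (fun u => by simp only [g, decide_eq_true_eq])
    exact h.mono (Nat.le_of_eq (by rw [hcard]))
  obtain ⟨C, hC, hs, he⟩ := (CktSize.gate (B := {g | IsPermGate (2 * (2 ^ (n + 1) + 1)) g})
    ⟨Fintype.card ι, g⟩ hg (fun i => eI.symm i)).toCircuit
  refine ⟨C, hC, hs, fun x => ?_⟩
  rw [he x]
  change decide ((((0 : Fin n → ZMod 2), (1 : ZMod 2)) : ι) ∉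
      Submodule.span (ZMod 2) ((fun i => eI.symm i) '' {i | x (eI.symm i) = false})) = _
  apply Bool.decide_congr
  -- `(0,1) ∉ span (unselected equations) ↔ the unselected system is satisfiable` (Fredholm over `𝔽₂`)
  have himg : (fun i => eI.symm i) '' {i : Fin (Fintype.card ι) | x (eI.symm i) = false} =
      {e : ι | x e = false} := by
    ext e
    simp only [Set.mem_image, Set.mem_setOf_eq]
    constructor
    · rintro ⟨i, hi, rfl⟩; exact hi
    · intro he; exact ⟨eI e, by simpa using he, by simp⟩
  rw [himg, zeroOne_mem_span_iff_xorUnsat, not_not]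
  exact Iff.rfl

end F2

end Summit.PneNP.PneNP.Theorems.Capture.DualityAudit
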